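import Mathlib
import HarnessLib
import Summits.HubbardSuperconductivity.HubbardSuperconductivity.Theorems.KLProgrammeKLRegimeSplitTwoLegSizesMSProfileOsc
import Summits.HubbardSuperconductivity.HubbardSuperconductivity.Theorems.KLProgrammeKLRegimeSplitTwoLegSizesMSDiffProfileSizes

/-!
# Route `KLProgramme`, crux K3 — (E3a-MS) supplier chain, TUBE RE-KEY (T1): the two generic profile-size lemmas with the symbol sizes
# restricted to the CURVE resp. to a set containing the SEGMENTS (k3c3-p1 g4)

Seat hubbard-kl-k3c3-p1 (g4).  The (E3a-MS) chain (`…TwoLegSizesMSChainTable*`, `…MSWithPiecesL`, `…MSQ`, `…MSProfiles`) asks for GLOBAL momentum-side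
sizes of the increment symbols (`∀ q : Momentum, ‖Dˡ evalM (S k) q‖ ≤ σ k l`); the engine certifies such sizes only on the flat tube of the scale
(`|frameLevel μ K q| ≤ d`; k3c5-p1 (O2), p1b `…TwoLegCoreTDTube`, k3c3-p3 MS-TRANSPORT §5(ii)).  The chain reads a symbol only AT the chain curves and on
the segments between consecutive ones, so the two generic lemmas it rests on re-key verbatim:

* **`curveProfile_centred_sizes_osc_on`** — `curveProfile_centred_sizes_osc` (`…MSProfileOsc`) with the symbol's sup and sizes `l ≤ 4` assumed only
  AT THE CURVE POINTS `k_F^{C}(θ)` (k3c3-p3's Bell bound `abs_iteratedDeriv_comp_le_bell` is pointwise);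
* **`comp_sub_centred_sizes_on`** — `comp_sub_centred_sizes` (`…MSDiffProfileSizes`) with the sizes `l ≤ 5` assumed on ANY set `T ⊇ segment ℝ (γ θ) (γ′ θ)`
  (all `θ`): the mean-value steps run on the segment (`convex_segment`), the Faà-di-Bruno differences are pointwise.

Proofs only (the originals' proofs with `Set.univ ↦ T`); nothing about the model.
-/

noncomputable section

namespace Summit.HubbardSuperconductivity.HubbardSuperconductivity.Theorems.KLRegimeSplit

set_option linter.dupNamespace false -- summit = problem name (single-conjunct summit), D-0017
set_option maxSynthPendingDepth 4 -- nested operator-norm instances (up to fifth Fréchet derivatives), as in `…CompDiff`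

open Real Finset MeasureTheory Literature.MathematicalPhysics.QuantumLattice Literature.MathematicalPhysics.QuantumLattice.FermiRG
open Summit.HubbardSuperconductivity.HubbardSuperconductivity.Theorems.KLProgrammeLegKernels
open Summit.HubbardSuperconductivity.HubbardSuperconductivity.Theorems.PerturbedFermiCurve

/-! ## §1 Centred angular sizes of ONE curve profile from sizes AT THE CURVE -/

/-- **CENTRED ANGULAR SIZES OF A CURVE PROFILE, oscillation entry, symbol sizes ON THE CURVE ONLY.**  As `curveProfile_centred_sizes_osc`, with
`|evalM S|` and `‖Dᵏ evalM S‖` (`1 ≤ k ≤ 4`) assumed only at the points `k_F^{C}(θ)` of the curve of the frame `C`. -/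
theorem curveProfile_centred_sizes_osc_on (μ : ℝ) (S C : TrigPolyC4v)
    (hγ : ContDiff ℝ 4 (fun θ => (WithLp.toLp 2 (klFermiPoint μ C θ) : Momentum))) {M D : ℕ → ℝ}
    (hMnn : ∀ k, 0 ≤ M k) (hDnn : ∀ i, 0 ≤ D i)
    (hM0 : ∀ θ : ℝ, |evalM S (WithLp.toLp 2 (klFermiPoint μ C θ))| ≤ M 0)
    (hM : ∀ k, 1 ≤ k → k ≤ 4 → ∀ θ : ℝ, ‖iteratedFDeriv ℝ k (evalM S) (WithLp.toLp 2 (klFermiPoint μ C θ))‖ ≤ M k)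
    (hD : ∀ i, 1 ≤ i → i ≤ 4 → ∀ θ, ‖iteratedDeriv i (fun θ => (WithLp.toLp 2 (klFermiPoint μ C θ) : Momentum)) θ‖ ≤ D i)
    {j : ℕ} (hj : j ≤ 4) {i : ℕ} (hi : i ≤ j) (t : ℝ) :
    ‖iteratedFDeriv ℝ i (fun t => curveProfile μ S C t - klAngularMean (curveProfile μ S C)) t‖ ≤ bellCumOsc M D j := by
  have hp : ∀ θ, |curveProfile μ S C θ| ≤ M 0 := fun θ => by
    rw [curveProfile_eq_comp]; exact hM0 θ
  rcases Nat.eq_zero_or_pos i with rfl | hipos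
  · -- order zero: both the `2 M₀` bound and the oscillation bound hold
    rw [norm_iteratedFDeriv_zero, Real.norm_eq_abs]
    have h2M : |curveProfile μ S C t - klAngularMean (curveProfile μ S C)| ≤ 2 * M 0 :=
      calc |curveProfile μ S C t - klAngularMean (curveProfile μ S C)|
          ≤ |curveProfile μ S C t| + |klAngularMean (curveProfile μ S C)| := abs_sub _ _
        _ ≤ M 0 + M 0 := add_le_add (hp t) (abs_klAngularMean_le' hp)
        _ = 2 * M 0 := by ring
    have hosc : |curveProfile μ S C t - klAngularMean (curveProfile μ S C)| ≤ 2 * π * (M 1 * D 1) := by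
      have hpc : ContDiff ℝ 4 (curveProfile μ S C) := by
        rw [curveProfile_eq_comp]; exact (contDiff_evalM S).comp hγ
      refine abs_sub_klAngularMean_le_of_deriv (hpc.differentiable (by norm_num)) (fun θ => ?_) (fun θ => ?_) t
      · simp only [curveProfile, klFermiPoint_periodic μ C θ]
      · have hB := (abs_iteratedDeriv_comp_le_bell (contDiff_evalM S) hγ (θ := θ) (M := M) (D := D)
          (fun k hk1 hk4 => hM k hk1 hk4 θ) (fun i hi1 hi4 => hD i hi1 hi4 θ)).1
        rw [iteratedDeriv_one, ← curveProfile_eq_comp] at hB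
        exact hB
    calc |curveProfile μ S C t - klAngularMean (curveProfile μ S C)|
        ≤ min (2 * M 0) (2 * π * (M 1 * D 1)) := le_min h2M hosc
      _ ≤ bellCumOsc M D j := by
          unfold bellCumOsc
          have := Finset.sum_nonneg fun i (_ : i ∈ Ico 1 (j + 1)) => bellTerm_nonneg hMnn hDnn i
          linarith
  · -- positive order: the Bell term
    refine le_trans ?_ (bellTerm_le_bellCumOsc hMnn hDnn hipos hi)
    rw [norm_iteratedFDeriv_eq_norm_iteratedDeriv, Real.norm_eq_abs]
    have e : (fun t => curveProfile μ S C t - klAngularMean (curveProfile μ S C)) =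
        fun t => -klAngularMean (curveProfile μ S C) + curveProfile μ S C t := by funext t; ring
    rw [e, iteratedDeriv_const_add hipos, curveProfile_eq_comp]
    have hB := abs_iteratedDeriv_comp_le_bell (contDiff_evalM S) hγ (θ := t) (M := M) (D := D)
      (fun k hk1 hk4 => hM k hk1 hk4 t) (fun i hi1 hi4 => hD i hi1 hi4 t)
    have hi4 : i ≤ 4 := hi.trans hj
    interval_cases i
    · simpa [bellTerm] using hB.1
    · simpa [bellTerm] using hB.2.1
    · simpa [bellTerm] using hB.2.2.1
    · simpa [bellTerm] using hB.2.2.2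

/-! ## §2 Centred angular sizes of a DIFFERENCE of two curve profiles from sizes on a set containing the segments -/

/-- Mean-value step on a segment: `‖g y − g x‖ ≤ C·‖y − x‖` for a differentiable `g` with `‖fderiv g‖ ≤ C` on a set `T ⊇ segment x y`. -/
theorem norm_sub_le_of_norm_fderiv_le_on_segment {V W : Type*} [NormedAddCommGroup V] [NormedSpace ℝ V] [NormedAddCommGroup W]
    [NormedSpace ℝ W] {g : V → W} (hg : Differentiable ℝ g) {T : Set V} {x y : V} (hT : segment ℝ x y ⊆ T) {C : ℝ}
    (hC : ∀ z ∈ T, ‖fderiv ℝ g z‖ ≤ C) : ‖g y - g x‖ ≤ C * ‖y - x‖ :=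
  (convex_segment x y).norm_image_sub_le_of_norm_fderiv_le (fun z _ => hg z) (fun z hz => hC z (hT hz))
    (left_mem_segment ℝ x y) (right_mem_segment ℝ x y)

/-- **CENTRED ANGULAR SIZES OF A DIFFERENCE OF TWO CURVE PROFILES, symbol sizes on a set `T ⊇` the segments.**  As `comp_sub_centred_sizes`
(`…MSDiffProfileSizes`) with `‖Dᵏ F‖ ≤ M k` (`1 ≤ k ≤ 5`) assumed only on a set `T` containing every segment `[γ θ, γ′ θ]`. -/
theorem comp_sub_centred_sizes_on {V : Type*} [NormedAddCommGroup V] [NormedSpace ℝ V] {F : V → ℝ} {γ γ' : ℝ → V}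
    (hF : ContDiff ℝ 5 F) (hγ : ContDiff ℝ 4 γ) (hγ' : ContDiff ℝ 4 γ') {T : Set V} (hT : ∀ θ, segment ℝ (γ θ) (γ' θ) ⊆ T)
    {M D dD : ℕ → ℝ} (hMnn : ∀ k, 0 ≤ M k) (hDnn : ∀ i, 0 ≤ D i) (hdDnn : ∀ i, 0 ≤ dD i)
    (hM : ∀ k, 1 ≤ k → k ≤ 5 → ∀ z ∈ T, ‖iteratedFDeriv ℝ k F z‖ ≤ M k)
    (hD : ∀ i, 1 ≤ i → i ≤ 4 → ∀ θ, ‖iteratedDeriv i γ θ‖ ≤ D i) (hD' : ∀ i, 1 ≤ i → i ≤ 4 → ∀ θ, ‖iteratedDeriv i γ' θ‖ ≤ D i)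
    (hdD0 : ∀ θ, ‖γ' θ - γ θ‖ ≤ dD 0)
    (hdD : ∀ i, 1 ≤ i → i ≤ 4 → ∀ θ, ‖iteratedDeriv i γ' θ - iteratedDeriv i γ θ‖ ≤ dD i)
    {j : ℕ} (hj : j ≤ 4) {i : ℕ} (hi : i ≤ j) (t : ℝ) :
    ‖iteratedFDeriv ℝ i (fun t => (F (γ' t) - F (γ t)) - klAngularMean (fun t => F (γ' t) - F (γ t))) t‖ ≤
      bellDiffCum M D dD j := by
  refine le_trans ?_ (bellDiffTerm_le_bellDiffCum hMnn hDnn hdDnn hi)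
  rw [norm_iteratedFDeriv_eq_norm_iteratedDeriv, Real.norm_eq_abs]
  have hF4 : ContDiff ℝ 4 F := hF.of_le (by norm_num)
  -- the curve points lie in `T`
  have hγT : ∀ θ, γ θ ∈ T := fun θ => hT θ (left_mem_segment ℝ _ _)
  -- nested sizes of `F` on `T`
  have hM₁ : ∀ z ∈ T, ‖fderiv ℝ F z‖ ≤ M 1 := fun z hz => by
    rw [norm_fderiv_eq_norm_iteratedFDeriv_one]; exact hM 1 le_rfl (by norm_num) z hz
  have hM₂ : ∀ z ∈ T, ‖fderiv ℝ (fderiv ℝ F) z‖ ≤ M 2 := fun z hz => by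
    rw [norm_fderiv_two_eq_norm_iteratedFDeriv]; exact hM 2 (by norm_num) (by norm_num) z hz
  have hM₃ : ∀ z ∈ T, ‖fderiv ℝ (fderiv ℝ (fderiv ℝ F)) z‖ ≤ M 3 := fun z hz => by
    rw [norm_fderiv_three_eq_norm_iteratedFDeriv]; exact hM 3 (by norm_num) (by norm_num) z hz
  have hM₄ : ∀ z ∈ T, ‖fderiv ℝ (fderiv ℝ (fderiv ℝ (fderiv ℝ F))) z‖ ≤ M 4 := fun z hz => by
    rw [norm_fderiv_four_eq_norm_iteratedFDeriv]; exact hM 4 (by norm_num) (by norm_num) z hz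
  have hM₅ : ∀ z ∈ T, ‖fderiv ℝ (fderiv ℝ (fderiv ℝ (fderiv ℝ (fderiv ℝ F)))) z‖ ≤ M 5 := fun z hz => by
    rw [norm_fderiv_five_eq_norm_iteratedFDeriv]; exact hM 5 (by norm_num) (by norm_num) z hz
  -- differentiability of the nested derivatives (global, from `F ∈ C⁵`)
  have hd0 : Differentiable ℝ F := hF.differentiable (by norm_num)
  have hd1 : Differentiable ℝ (fderiv ℝ F) := (hF.fderiv_right (m := 4) (by norm_num)).differentiable (by norm_num)
  have hd2 : Differentiable ℝ (fderiv ℝ (fderiv ℝ F)) :=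
    ((hF.fderiv_right (m := 4) (by norm_num)).fderiv_right (m := 3) (by norm_num)).differentiable (by norm_num)
  have hd3 : Differentiable ℝ (fderiv ℝ (fderiv ℝ (fderiv ℝ F))) :=
    (((hF.fderiv_right (m := 4) (by norm_num)).fderiv_right (m := 3) (by norm_num)).fderiv_right (m := 2)
      (by norm_num)).differentiable (by norm_num)
  have hd4 : Differentiable ℝ (fderiv ℝ (fderiv ℝ (fderiv ℝ (fderiv ℝ F)))) :=
    ((((hF.fderiv_right (m := 4) (by norm_num)).fderiv_right (m := 3) (by norm_num)).fderiv_right (m := 2)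
      (by norm_num)).fderiv_right (m := 1) (by norm_num)).differentiable one_ne_zero
  -- order zero of the difference: mean value on the segment
  have h0 : ∀ θ, |F (γ' θ) - F (γ θ)| ≤ M 1 * dD 0 := fun θ => by
    have h := norm_sub_le_of_norm_fderiv_le_on_segment hd0 (hT θ) hM₁
    rw [Real.norm_eq_abs] at h
    exact h.trans (mul_le_mul_of_nonneg_left (hdD0 θ) (hMnn 1))
  rcases Nat.eq_zero_or_pos i with rfl | hipos
  · simp only [iteratedDeriv_zero, bellDiffTerm]
    calc |F (γ' t) - F (γ t) - klAngularMean fun t => F (γ' t) - F (γ t)|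
        ≤ |F (γ' t) - F (γ t)| + |klAngularMean fun t => F (γ' t) - F (γ t)| := abs_sub _ _
      _ ≤ M 1 * dD 0 + M 1 * dD 0 := add_le_add (h0 t) (abs_klAngularMean_le' h0)
      _ = 2 * (M 1 * dD 0) := by ring
  · have e : (fun t => F (γ' t) - F (γ t) - klAngularMean fun t => F (γ' t) - F (γ t)) =
        fun t => -(klAngularMean fun t => F (γ' t) - F (γ t)) + ((F ∘ γ') - (F ∘ γ)) t := by
      funext t; simp only [Pi.sub_apply, Function.comp]; ring
    have hi4 : i ≤ 4 := hi.trans hj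
    have hc' : ContDiffAt ℝ i (F ∘ γ') t := ((hF4.comp hγ').of_le (by exact_mod_cast hi4)).contDiffAt
    have hc : ContDiffAt ℝ i (F ∘ γ) t := ((hF4.comp hγ).of_le (by exact_mod_cast hi4)).contDiffAt
    rw [e, iteratedDeriv_const_add hipos, iteratedDeriv_sub hc' hc]
    -- the `Φ_k` on the segment
    have hΦ₁ : ‖fderiv ℝ F (γ' t) - fderiv ℝ F (γ t)‖ ≤ M 2 * dD 0 :=
      (norm_sub_le_of_norm_fderiv_le_on_segment hd1 (hT t) hM₂).trans (mul_le_mul_of_nonneg_left (hdD0 t) (hMnn 2))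
    have hΦ₂ : ‖fderiv ℝ (fderiv ℝ F) (γ' t) - fderiv ℝ (fderiv ℝ F) (γ t)‖ ≤ M 3 * dD 0 :=
      (norm_sub_le_of_norm_fderiv_le_on_segment hd2 (hT t) hM₃).trans (mul_le_mul_of_nonneg_left (hdD0 t) (hMnn 3))
    have hΦ₃ : ‖fderiv ℝ (fderiv ℝ (fderiv ℝ F)) (γ' t) - fderiv ℝ (fderiv ℝ (fderiv ℝ F)) (γ t)‖ ≤ M 4 * dD 0 :=
      (norm_sub_le_of_norm_fderiv_le_on_segment hd3 (hT t) hM₄).trans (mul_le_mul_of_nonneg_left (hdD0 t) (hMnn 4))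
    have hΦ₄ : ‖fderiv ℝ (fderiv ℝ (fderiv ℝ (fderiv ℝ F))) (γ' t) - fderiv ℝ (fderiv ℝ (fderiv ℝ (fderiv ℝ F))) (γ t)‖ ≤
        M 5 * dD 0 :=
      (norm_sub_le_of_norm_fderiv_le_on_segment hd4 (hT t) hM₅).trans (mul_le_mul_of_nonneg_left (hdD0 t) (hMnn 5))
    have hD₁ := hD 1 le_rfl (by norm_num) t; have hD₂ := hD 2 (by norm_num) (by norm_num) t
    have hD₃ := hD 3 (by norm_num) (by norm_num) t
    have hD₁' := hD' 1 le_rfl (by norm_num) t; have hD₂' := hD' 2 (by norm_num) (by norm_num) t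
    have hD₃' := hD' 3 (by norm_num) (by norm_num) t; have hD₄' := hD' 4 (by norm_num) (by norm_num) t
    have hdD₁ := hdD 1 le_rfl (by norm_num) t; have hdD₂ := hdD 2 (by norm_num) (by norm_num) t
    have hdD₃ := hdD 3 (by norm_num) (by norm_num) t; have hdD₄ := hdD 4 (by norm_num) (by norm_num) t
    interval_cases i
    · simpa [bellDiffTerm] using abs_iteratedDeriv_one_comp_sub_le hF4 hγ hγ' (hM₁ _ (hγT t)) hΦ₁ hD₁' hdD₁
    · have h := abs_iteratedDeriv_two_comp_sub_le hF4 hγ hγ' (hM₁ _ (hγT t)) (hM₂ _ (hγT t)) hΦ₁ hΦ₂ hD₁ hD₁' hD₂' hdD₁ hdD₂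
      simp only [bellDiffTerm]; linarith
    · have h := abs_iteratedDeriv_three_comp_sub_le hF4 hγ hγ' (hM₁ _ (hγT t)) (hM₂ _ (hγT t)) (hM₃ _ (hγT t)) hΦ₁ hΦ₂ hΦ₃ hD₁
        hD₁' hD₂ hD₂' hD₃' hdD₁ hdD₂ hdD₃
      simp only [bellDiffTerm]; linarith
    · have h := abs_iteratedDeriv_four_comp_sub_le hF4 hγ hγ' (hM₁ _ (hγT t)) (hM₂ _ (hγT t)) (hM₃ _ (hγT t)) (hM₄ _ (hγT t))
        hΦ₁ hΦ₂ hΦ₃ hΦ₄ hD₁ hD₁' hD₂ hD₂' hD₃ hD₃' hD₄' hdD₁ hdD₂ hdD₃ hdD₄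
      simp only [bellDiffTerm]; linarith

end Summit.HubbardSuperconductivity.HubbardSuperconductivity.Theorems.KLRegimeSplit

end
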